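import Summits.BirchSwinnertonDyer.Rank1Residual.X11b.PadicComplexTransport
import Summits.BirchSwinnertonDyer.Rank1Residual.X11b.PadicExponentTwist
import Summits.BirchSwinnertonDyer.Rank1Residual.X11b.PadicInertiaCharacterLimit
import Summits.BirchSwinnertonDyer.Rank1Residual.X11b.PadicLangTate
import HarnessLib

/-!
# X11b · S29 K3 (T3 + assembly = `hSen`): no non-zero semi-invariant of `ℂ_p` for a RAMIFIED
# exponent character — Lang's theorem + Tate's theorem, every prime `p` (theorems only)

HONEST FRAMING (cell `b2b-bsdres`, run/shared/lean/b2b/bsd-rank1-residual/, verbatim in every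
file): the goal of the cell is to DELETE the COMBINATION-SHAPED residual classes of the
Birch–Swinnerton-Dyer formula for ALL analytic-rank `≤ 1` elliptic curves over `ℚ` — assembled
STRICTLY from published theorems — so that the rank-`≤ 1` remainder becomes exactly the
CONSTRUCTION-SHAPED classes, which are TYPED, NOT attempted. This is not "finishing BSD". Team
`x11b3` = N8/O2 (X11b at `p = 3`): research routes; nothing booked; no label change; O2 OPEN; the
node of record `Three.HsiehDescentAt₃` is UNCHANGED by this file (sub-target S29 RE-EXPRESSES (t)
⟸ (VR); lead GEN 8 R9-8 / R9-25 / R9-30).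

PROVENANCE: S29 kernel package K3 = [T2 T3 T4 T5] (lead R9-25/R9-27/R9-30), the hypothesis `hSen`
of x11b3-p7's K4 (`HOME/b2b-bsdres-x11b3-p7/s25/K4-INTERFACES.md`; r2's (T′),
`HOME/b2b-bsdres-x11b3-r2/gen12/S29-0c-QK2b-r2.md` §5), seat `b2b-bsdres-x11b3-p1` GEN 3.
The (T2) inputs — the local Kronecker–Weber theorem at `p` in INERTIA form for `ℚ_[p]`
(`χ_p(I) = ℤ_pˣ` and "every continuous `a : Γ_{ℚ_p} → ℤ_p` restricted to inertia factors
continuously through `χ_p`"; tree `LocalKroneckerWeberInertiaProofs` for `v.adicCompletion ℚ`,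
re-run for `ℚ_[p]` by x11b3-p5: `X11b/PadicInertiaCharacter(Limit).lean`,
`PadicInertiaCharacter.exists_continuousMonoidHom_factor`) — enter §3–§4 as the LABELLED HYPOTHESIS
`hLKW` (shape (T2-ii); (T2-i) `χ_p(I) = ℤ_pˣ` is not consumed here) and are DISCHARGED in §5, so
that the final statements `eq_zero_of_forall_smul_eq_exp'` and
`apply_eq_zero_of_forall_exists_semiInvariant` are unconditional.

## What is proved

* inputs from `X11b/PadicLangTate.lean` (same namespace): Lang's theorem in `ℂ_F` for an
  unramified rank-one character (`exists_norm_eq_one_forall_smul_eq_of_unramified`) and Tate's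
  theorem for `ℚ_[p]` with plain scalars (`eq_zero_of_forall_smul_eq_cyclotomicCharacter_pow_padic`).
* §3 **`eq_zero_of_forall_smul_eq_exp`** (tree side): for a continuous `a : Γ_{ℚ_p} →ₜ* ℤ_p`
  NON-TRIVIAL ON INERTIA and every `i`, there is `s ∈ p^i ℤ_p ∖ {0}` such that NO non-zero
  `x ∈ ℂ_{ℚ_p}` satisfies `σ • x = γ^{s·a(σ)} x` for all `σ` (`γ = 1 + p³`, `γ^{y} := e(y)`): on
  inertia `γ^{s a} = χ^j` exactly (`PadicExponentTwist.exists_exp_mul_apply_eq_pow`), so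
  `γ^{s a} χ^{-j}` is unramified, Lang untwists it, and Tate kills `χ^j`.
* §4–§5 **`apply_eq_zero_of_forall_exists_semiInvariant` = `hSen`** (Mathlib side, x11b3-p7's
  `K4-INTERFACES.md` v3 shape VERBATIM, every prime `p`): for ANY family of continuous extensions
  `T τ` of the `τ ∈ Aut(ℚ̄_p/ℚ_p)` to `ℂ_[p]` and an additive continuous `a : Aut(ℚ̄_p/ℚ_p) → ℤ_p`:
  if for some `δ > 0` every `ℚ_p`-RATIONAL base point `w`, `‖w - 1‖ < δ`, and every continuous
  `ψ : ℤ_p → ℂ_pˣ` with `ψ(1) = w` admit `q ≠ 0` with `T τ q = ψ(a τ) q` for all `τ`, then `a τ = 0`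
  for every `τ` fixing the prime-to-`p` roots of unity — transported along `e : ℂ_{ℚ_p} ≃+* ℂ_[p]`
  (`X11b/PadicComplexTransport`; `T τ = e σ e⁻¹` by uniqueness of continuous extensions) from §3
  with `w = γ^s`, `ψ = ψ_s : y ↦ γ^{s y}`, `‖γ^s - 1‖ ≤ p^{-(i+3)}`.

No definition, no named fact, no `sorry`.

References: [Tate1967] §3.3 Thm. 2; [SerreLocalFields1979] Ch. XIII §5 (Lang), Ch. XIV §7 Thm. 2
(local Kronecker–Weber); Serre, *A Course in Arithmetic*, Ch. II §3.2; [FontaineOuyang2022] §3.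
-/

noncomputable section

open Field ValuativeRel UniformSpace Filter
open scoped Topology

namespace Summit.BirchSwinnertonDyer.Rank1Residual.X11b.PadicSemiInvariant

open Literature.NumberTheory.PAdicHodge
open Literature.NumberTheory.GaloisRepresentations
open Literature.NumberTheory.GaloisRepresentations.IsNonarchimedeanLocalField
open Literature.NumberTheory.EllipticCurves.ZpExtension
open Summit.BirchSwinnertonDyer.Rank1Residual.X11b.PadicComplexTransport
open Summit.BirchSwinnertonDyer.Rank1Residual.X11b.PadicExponentTwist

/-! ### §3 No non-zero semi-invariant for a ramified exponent character (tree side) -/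

section Padic

variable {p : ℕ} [Fact p.Prime] [IsNonarchimedeanLocalField ℚ_[p]]

/-- **No non-zero semi-invariant for a ramified exponent character.** Let `e` be the `γ`-adic
exponential (`e 1 = 1 + p³`, continuous) and `a : Γ_{ℚ_p} →ₜ* ℤ_p` a continuous character which is
NOT trivial on the inertia group. Assume the local Kronecker–Weber input `hLKW`
(`a|_I = f ∘ χ_p|_I` for a continuous `f : ℤ_pˣ →ₜ* ℤ_p`; Serre LF XIV §7 Thm. 2 in inertia form). Then for every `i` there is
`s ∈ p^i ℤ_p`, `s ≠ 0`, such that every `x ∈ ℂ_{ℚ_p}` with `σ • x = e(s · a(σ)) · x` for all `σ` is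
`0`. Proof: by `PadicExponentTwist.exists_exp_mul_apply_eq_pow`, `e(s · f(u)) = u^j` (`j ≥ 1`) for
all units `u`, so `B(σ) = e(s a(σ))` equals `χ_p(σ)^j` on inertia; `ψ = B · χ_p^{-j}` is unramified,
Lang (§1) gives a unit `Z` with `σ • Z = ψ(σ)⁻¹ Z`, and `x Z` is a semi-invariant for `χ_p^j`, hence
`0` by Tate (§2). [cite: Tate1967, §3.3 Theorem 2] [cite: SerreLocalFields1979, Ch. XIII §5] -/
theorem eq_zero_of_forall_smul_eq_exp (e : AddChar ℤ_[p] ℤ_[p]) (he : Continuous e)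
    (he1 : e 1 = 1 + (p : ℤ_[p]) ^ 3) (a : absoluteGaloisGroup ℚ_[p] →ₜ* Multiplicative ℤ_[p])
    (hLKW : ∃ f : ℤ_[p]ˣ →ₜ* Multiplicative ℤ_[p], ∀ σ ∈ absInertia ℚ_[p],
      a σ = f (GaloisRep.cyclotomicCharacter ℚ_[p] p σ))
    (hram : ∃ σ ∈ absInertia ℚ_[p], a σ ≠ 1) (i : ℕ) :
    ∃ s : ℤ_[p], s ≠ 0 ∧ (p : ℤ_[p]) ^ i ∣ s ∧
      ∀ x : CompletedAlgClosure ℚ_[p],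
        (∀ σ : absoluteGaloisGroup ℚ_[p], σ • x =
          algebraMap ℚ_[p] (CompletedAlgClosure ℚ_[p]) ((e (s * (a σ).toAdd) : ℤ_[p]) : ℚ_[p]) * x) →
        x = 0 := by
  set χ := GaloisRep.cyclotomicCharacter ℚ_[p] p with hχ_def
  obtain ⟨f, hf⟩ := hLKW
  have hf1 : ∃ u, f u ≠ 1 := by
    obtain ⟨σ, hσ, hne⟩ := hram
    exact ⟨χ σ, by rw [← hf σ hσ]; exact hne⟩
  obtain ⟨s, j, hs0, hsd, hj, hkey⟩ := exists_exp_mul_apply_eq_pow e he he1 f hf1 i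
  refine ⟨s, hs0, hsd, fun x hx => ?_⟩
  -- the exponent character `B σ = e(s a σ)` as a continuous hom into units
  set E := e.toMonoidHom.toHomUnits with hE_def
  set ms : Multiplicative ℤ_[p] →* Multiplicative ℤ_[p] := (AddMonoidHom.mulLeft s).toMultiplicative
    with hms_def
  have hms_cont : Continuous ms := by
    change Continuous fun y : Multiplicative ℤ_[p] => Multiplicative.ofAdd (s * y.toAdd)
    exact continuous_ofAdd.comp (continuous_const.mul continuous_toAdd)
  set B : absoluteGaloisGroup ℚ_[p] →ₜ* ℤ_[p]ˣ :=
    { toMonoidHom := E.comp (ms.comp (a : absoluteGaloisGroup ℚ_[p] →* Multiplicative ℤ_[p]))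
      continuous_toFun := (continuous_expUnits he).comp (hms_cont.comp a.continuous) } with hB_def
  have hB : ∀ σ, ((B σ : ℤ_[p]ˣ) : ℤ_[p]) = e (s * (a σ).toAdd) := fun σ => rfl
  -- on inertia `B = χ ^ j`
  have hBI : ∀ σ ∈ absInertia ℚ_[p], B σ = χ σ ^ j := by
    intro σ hσ
    refine Units.ext ?_
    rw [hB, hf σ hσ, Units.val_pow_eq_pow_val, hkey]
  -- the unramified character `ψ = B χ^{-j}`
  set ψ : absoluteGaloisGroup ℚ_[p] →ₜ* ℤ_[p]ˣ :=
    { toFun := fun σ => B σ * (χ σ ^ j)⁻¹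
      map_one' := by rw [map_one, map_one, one_pow, inv_one, mul_one]
      map_mul' := fun σ τ => by rw [map_mul, map_mul, mul_pow, mul_inv]; exact mul_mul_mul_comm _ _ _ _
      continuous_toFun := B.continuous.mul ((χ.continuous.pow j).inv) } with hψ_def
  have hψ_apply : ∀ σ, ψ σ = B σ * (χ σ ^ j)⁻¹ := fun σ => rfl
  have hψI : ∀ σ ∈ absInertia ℚ_[p], ψ σ = 1 := fun σ hσ => by
    rw [hψ_apply, hBI σ hσ, mul_inv_cancel]
  -- Lang
  obtain ⟨Z, hZ1, hZ⟩ := exists_norm_eq_one_forall_smul_eq_of_unramified (F := ℚ_[p]) ψ hψI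
  have hZ0 : Z ≠ 0 := fun h => by rw [h, norm_zero] at hZ1; exact zero_ne_one hZ1
  -- `x Z` is a semi-invariant for `χ^j`
  set ι : ℤ_[p] →+* CompletedAlgClosure ℚ_[p] :=
    (algebraMap ℚ_[p] (CompletedAlgClosure ℚ_[p])).comp (PadicInt.Coe.ringHom (p := p)) with hι_def
  have hι : ∀ u : ℤ_[p], ι u = algebraMap ℚ_[p] (CompletedAlgClosure ℚ_[p]) (u : ℚ_[p]) := fun _ => rfl
  have hxZ : ∀ σ : absoluteGaloisGroup ℚ_[p], σ • (x * Z) =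
      (algebraMap ℚ_[p] (CompletedAlgClosure ℚ_[p]) (((χ σ : ℤ_[p]ˣ) : ℤ_[p]) : ℚ_[p])) ^ j * (x * Z) := by
    intro σ
    rw [smul_mul', hx σ, hZ σ, Algebra.algebraMap_self_apply, ← hB, ← hι, ← hι, ← hι,
      ← map_pow, ← Units.val_pow_eq_pow_val, hψ_apply, mul_inv_rev, inv_inv]
    have hu : ((B σ : ℤ_[p]ˣ) : ℤ_[p]) * ((((χ σ ^ j) * (B σ)⁻¹ : ℤ_[p]ˣ)) : ℤ_[p]) =
        ((χ σ ^ j : ℤ_[p]ˣ) : ℤ_[p]) := by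
      rw [← Units.val_mul, mul_comm, inv_mul_cancel_right]
    calc ι (B σ : ℤ_[p]) * x * (ι (((χ σ ^ j) * (B σ)⁻¹ : ℤ_[p]ˣ) : ℤ_[p]) * Z)
        = (ι (B σ : ℤ_[p]) * ι (((χ σ ^ j) * (B σ)⁻¹ : ℤ_[p]ˣ) : ℤ_[p])) * (x * Z) := by ring
      _ = ι ((χ σ ^ j : ℤ_[p]ˣ) : ℤ_[p]) * (x * Z) := by rw [← map_mul, hu]
  -- Tate
  have h0 : x * Z = 0 := eq_zero_of_forall_smul_eq_cyclotomicCharacter_pow_padic hj.ne' hxZ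
  exact (mul_eq_zero.mp h0).resolve_right hZ0

/-! ### §4 `hSen` (x11b3-p7's K4 interface v3, Mathlib side) -/

omit [IsNonarchimedeanLocalField ℚ_[p]] in
/-- The `γ`-adic character `ψ_s : y ↦ e(s y)` read in `ℂ_[p]ˣ`, as a monoid homomorphism
`Multiplicative ℤ_p →* ℂ_[p]ˣ` (term `(Units.map ι₀) ∘ e.toMonoidHom.toHomUnits ∘ (y ↦ s y)` with
`ι₀ : ℤ_p → ℚ_p → ℂ_p`): its value at `y`. [folklore] -/
theorem coe_expUnitsChar_apply (e : AddChar ℤ_[p] ℤ_[p]) (s : ℤ_[p]) (y : Multiplicative ℤ_[p]) :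
    (((Units.map (((algebraMap ℚ_[p] ℂ_[p]).comp (PadicInt.Coe.ringHom (p := p))).toMonoidHom)).comp
        (e.toMonoidHom.toHomUnits.comp (AddMonoidHom.mulLeft s).toMultiplicative) y : ℂ_[p]ˣ) : ℂ_[p]) =
      algebraMap ℚ_[p] ℂ_[p] ((e (s * y.toAdd) : ℤ_[p]) : ℚ_[p]) := rfl

/-- **S29 K4's hypothesis `hSen` (v3), proved from (T2-ii)** (every prime `p`; x11b3-p7's
`K4-INTERFACES.md` v3 shape verbatim, K4 instantiates `p := 3`). Fix ANY family of continuous ring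
endomorphisms `T τ` of `ℂ_[p]` extending the automorphisms `τ ∈ Aut(ℚ̄_p/ℚ_p)`. Let
`a : Aut(ℚ̄_p/ℚ_p) → ℤ_p` be additive and continuous (Krull topology). Suppose there is `δ > 0` such
that for every `w ∈ ℚ_p` with `‖w - 1‖ < δ` and every continuous `ψ : ℤ_p → ℂ_pˣ` with `ψ(1) = w`
there is `q ≠ 0` in `ℂ_[p]` with `T τ q = ψ(a τ) · q` for all `τ`. Then `a τ = 0` for every `τ`
fixing the roots of unity of order prime to `p` (`a` is unramified). Input: `hLKW` = local
Kronecker–Weber in inertia form for `ℚ_[p]` (Serre LF XIV §7 Thm. 2: every continuous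
`Γ_{ℚ_p} →ₜ* ℤ_p` restricted to inertia factors continuously through `χ_p`), a labelled hypothesis
(discharged in §5 by x11b3-p5's `PadicInertiaCharacter.exists_continuousMonoidHom_factor`).
Proof: if `a τ₀ ≠ 0` with `τ₀` an inertia element, take `s`
from `eq_zero_of_forall_smul_eq_exp` with `p^{-(i+3)} < δ`, `w = e(s) = γ^s` and
`ψ = ψ_s : y ↦ γ^{s y}`; the given `q ≠ 0`, pulled back along `e : ℂ_{ℚ_p} ≃+* ℂ_[p]`
(`exists_ringEquiv_padicComplex`; `T τ` agrees with the transported action by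
`ringHom_padicComplex_ext`), is a non-zero semi-invariant for `σ ↦ γ^{s a(σ)}` — contradiction.
NO Sen theory is used. [cite: Tate1967, §3.3 Theorem 2] [cite: SerreLocalFields1979, Ch. XIV §7 Thm. 2] -/
theorem apply_eq_zero_of_forall_exists_semiInvariant_of_factor
    (hLKW : ∀ a : absoluteGaloisGroup ℚ_[p] →ₜ* Multiplicative ℤ_[p],
      ∃ f : ℤ_[p]ˣ →ₜ* Multiplicative ℤ_[p], ∀ σ ∈ absInertia ℚ_[p],
        a σ = f (GaloisRep.cyclotomicCharacter ℚ_[p] p σ))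
    (T : (PadicAlgCl p ≃ₐ[ℚ_[p]] PadicAlgCl p) → ℂ_[p] →+* ℂ_[p]) (hT : ∀ τ, Continuous (T τ))
    (hTτ : ∀ τ (x : PadicAlgCl p), T τ x = τ x)
    (a : (PadicAlgCl p ≃ₐ[ℚ_[p]] PadicAlgCl p) → ℤ_[p]) (hadd : ∀ τ₁ τ₂, a (τ₁ * τ₂) = a τ₁ + a τ₂)
    (hcont : Continuous a)
    (H : ∃ δ : ℝ, 0 < δ ∧ ∀ (w : ℚ_[p]) (ψ : Multiplicative ℤ_[p] →* ℂ_[p]ˣ), Continuous ψ →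
      ((ψ (Multiplicative.ofAdd 1) : ℂ_[p]ˣ) : ℂ_[p]) = algebraMap ℚ_[p] ℂ_[p] w →
      ‖algebraMap ℚ_[p] ℂ_[p] w - 1‖ < δ →
      ∃ q : ℂ_[p], q ≠ 0 ∧ ∀ τ, T τ q = ((ψ (Multiplicative.ofAdd (a τ)) : ℂ_[p]ˣ) : ℂ_[p]) * q)
    (τ : PadicAlgCl p ≃ₐ[ℚ_[p]] PadicAlgCl p)
    (hτ : ∀ ζ : PadicAlgCl p, (∃ m : ℕ, 0 < m ∧ ¬ p ∣ m ∧ ζ ^ m = 1) → τ ζ = ζ) :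
    a τ = 0 := by
  have hp : p.Prime := Fact.out
  obtain ⟨δ, hδ, H⟩ := H
  by_contra hne
  -- `a` as a continuous character of `Γ_{ℚ_p}`
  have ha0 : a 1 = 0 := by
    have h := hadd 1 1
    rw [mul_one] at h
    exact left_eq_add.mp h
  set a' : absoluteGaloisGroup ℚ_[p] →ₜ* Multiplicative ℤ_[p] :=
    { toFun := fun σ => Multiplicative.ofAdd (a (absoluteGaloisGroup.toAlgEquiv ℚ_[p] σ))
      map_one' := by simp [ha0]
      map_mul' := fun σ₁ σ₂ => by rw [map_mul, ← ofAdd_add, ← hadd]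
      continuous_toFun := continuous_ofAdd.comp hcont } with ha'_def
  have ha' : ∀ σ, (a' σ).toAdd = a (absoluteGaloisGroup.toAlgEquiv ℚ_[p] σ) := fun _ => rfl
  -- `τ` is an inertia element on which `a'` is non-trivial
  have hτI : ((absoluteGaloisGroup.toAlgEquiv ℚ_[p]).symm τ) ∈ absInertia ℚ_[p] :=
    mem_absInertia_of_forall_rootsOfUnity (by rw [MulEquiv.apply_symm_apply]; exact hτ)
  have hram : ∃ σ ∈ absInertia ℚ_[p], a' σ ≠ 1 := by
    refine ⟨_, hτI, fun h => hne ?_⟩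
    have h' := congrArg Multiplicative.toAdd h
    rw [ha', MulEquiv.apply_symm_apply, toAdd_one] at h'
    exact h'
  -- the exponential and the scale `s`
  obtain ⟨e, he, he1⟩ := PadicUnits.exists_continuous_addChar (p := p)
  obtain ⟨i, hi⟩ : ∃ i : ℕ, ((p : ℝ)⁻¹) ^ (3 + i) < δ := by
    obtain ⟨i, hi⟩ := exists_pow_lt_of_lt_one hδ
      (inv_lt_one_of_one_lt₀ (show (1 : ℝ) < p by exact_mod_cast hp.one_lt))
    refine ⟨i, lt_of_le_of_lt ?_ hi⟩
    exact pow_le_pow_of_le_one (inv_nonneg.2 (by exact_mod_cast hp.pos.le))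
      (inv_le_one_of_one_le₀ (by exact_mod_cast hp.one_lt.le)) (by omega)
  obtain ⟨s, hs0, hsd, hkill⟩ := eq_zero_of_forall_smul_eq_exp e he he1 a' (hLKW a') hram i
  -- the small character `ψ_s : y ↦ γ^{s y}` with base point `w = e(s) ∈ ℚ_p`
  set ι₀ : ℤ_[p] →+* ℂ_[p] := (algebraMap ℚ_[p] ℂ_[p]).comp (PadicInt.Coe.ringHom (p := p)) with hι₀
  set ψ : Multiplicative ℤ_[p] →* ℂ_[p]ˣ :=
    (Units.map ι₀.toMonoidHom).comp
      (e.toMonoidHom.toHomUnits.comp (AddMonoidHom.mulLeft s).toMultiplicative) with hψ_def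
  have hψ_apply : ∀ y : Multiplicative ℤ_[p],
      ((ψ y : ℂ_[p]ˣ) : ℂ_[p]) = algebraMap ℚ_[p] ℂ_[p] ((e (s * y.toAdd) : ℤ_[p]) : ℚ_[p]) :=
    coe_expUnitsChar_apply e s
  have hψc : Continuous ψ := by
    refine Units.continuous_iff.2 ⟨?_, ?_⟩
    · change Continuous fun y : Multiplicative ℤ_[p] => ((ψ y : ℂ_[p]ˣ) : ℂ_[p])
      have : (fun y : Multiplicative ℤ_[p] => ((ψ y : ℂ_[p]ˣ) : ℂ_[p])) =
          fun y => algebraMap ℚ_[p] ℂ_[p] ((e (s * y.toAdd) : ℤ_[p]) : ℚ_[p]) := funext hψ_apply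
      rw [this]
      exact (continuous_algebraMap ℚ_[p] ℂ_[p]).comp
        (continuous_subtype_val.comp (he.comp (continuous_const.mul continuous_toAdd)))
    · change Continuous fun y : Multiplicative ℤ_[p] => ((ψ y)⁻¹ : ℂ_[p]ˣ).val
      have : (fun y : Multiplicative ℤ_[p] => ((ψ y)⁻¹ : ℂ_[p]ˣ).val) =
          fun y => algebraMap ℚ_[p] ℂ_[p] ((e (s * (y⁻¹).toAdd) : ℤ_[p]) : ℚ_[p]) := by
        funext y; rw [← map_inv, hψ_apply]
      rw [this]
      exact (continuous_algebraMap ℚ_[p] ℂ_[p]).comp (continuous_subtype_val.comp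
        (he.comp (continuous_const.mul (continuous_toAdd.comp continuous_inv))))
  have hψ1 : ((ψ (Multiplicative.ofAdd 1) : ℂ_[p]ˣ) : ℂ_[p]) =
      algebraMap ℚ_[p] ℂ_[p] ((e s : ℤ_[p]) : ℚ_[p]) := by
    rw [hψ_apply, toAdd_ofAdd, mul_one]
  have hw : ‖algebraMap ℚ_[p] ℂ_[p] ((e s : ℤ_[p]) : ℚ_[p]) - 1‖ < δ := by
    have h1 : ‖e s - 1‖ ≤ ((p : ℝ)⁻¹) ^ (3 + i) := by
      have hd := prime_pow_dvd_exp_sub_one e he he1 hsd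
      rw [← Ideal.mem_span_singleton, ← PadicInt.norm_le_pow_iff_mem_span_pow] at hd
      simpa only [zpow_neg, zpow_natCast, inv_pow] using hd
    have h2 : ‖algebraMap ℚ_[p] ℂ_[p] ((e s : ℤ_[p]) : ℚ_[p]) - 1‖ = ‖e s - 1‖ := by
      rw [← map_one (algebraMap ℚ_[p] ℂ_[p]), ← map_sub, norm_algebraMap', ← PadicInt.coe_one,
        ← PadicInt.coe_sub]
      rfl
    rw [h2]
    exact lt_of_le_of_lt h1 hi
  obtain ⟨q, hq0, hq⟩ := H _ ψ hψc hψ1 hw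
  -- transport to `ℂ_{ℚ_p}`
  obtain ⟨c, hc, ec, hec_coe, -, hecu, hecsu⟩ := exists_ringEquiv_padicComplex p
  set x' : CompletedAlgClosure ℚ_[p] := ec.symm q with hx'_def
  have hx'0 : x' ≠ 0 := fun h => hq0 (by
    rw [← ec.apply_symm_apply q, ← hx'_def, h, map_zero])
  refine hx'0 (hkill x' fun σ => ?_)
  obtain ⟨Tσ, hTσc, hTσ, hTe⟩ :=
    exists_continuous_ringHom_padicComplex_extending ec hecu.continuous hecsu.continuous hec_coe σ
  -- the given family agrees with the transported action (uniqueness of continuous extensions)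
  have hTT : T (absoluteGaloisGroup.toAlgEquiv ℚ_[p] σ) = Tσ :=
    ringHom_padicComplex_ext (hT _) hTσc fun y => by rw [hTτ, hTσ]
  have hTq := hq (absoluteGaloisGroup.toAlgEquiv ℚ_[p] σ)
  rw [hTT] at hTq
  apply ec.injective
  rw [← hTe, hx'_def, RingEquiv.apply_symm_apply, hTq, map_mul, RingEquiv.apply_symm_apply,
    hψ_apply, toAdd_ofAdd, ← ha', ringEquiv_padicComplex_algebraMap hec_coe,
    IsScalarTower.algebraMap_apply ℚ_[p] (PadicAlgCl p) ℂ_[p]]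
  rfl

/-! ### §5 The unconditional forms ((T2-ii) supplied by `X11b/PadicInertiaCharacterLimit`) -/

/-- **No non-zero semi-invariant for a ramified exponent character — UNCONDITIONAL**: the input
`hLKW` of `eq_zero_of_forall_smul_eq_exp` is the tree theorem
`PadicInertiaCharacter.exists_continuousMonoidHom_factor` (x11b3-p5; Serre LF XIV §7 Thm. 2 in
inertia form for `ℚ_[p]`, `ℤ_p`-valued limit). [cite: SerreLocalFields1979, Ch. XIV §7 Thm. 2] -/
theorem eq_zero_of_forall_smul_eq_exp' (e : AddChar ℤ_[p] ℤ_[p]) (he : Continuous e)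
    (he1 : e 1 = 1 + (p : ℤ_[p]) ^ 3) (a : absoluteGaloisGroup ℚ_[p] →ₜ* Multiplicative ℤ_[p])
    (hram : ∃ σ ∈ absInertia ℚ_[p], a σ ≠ 1) (i : ℕ) :
    ∃ s : ℤ_[p], s ≠ 0 ∧ (p : ℤ_[p]) ^ i ∣ s ∧
      ∀ x : CompletedAlgClosure ℚ_[p],
        (∀ σ : absoluteGaloisGroup ℚ_[p], σ • x =
          algebraMap ℚ_[p] (CompletedAlgClosure ℚ_[p]) ((e (s * (a σ).toAdd) : ℤ_[p]) : ℚ_[p]) * x) →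
        x = 0 :=
  eq_zero_of_forall_smul_eq_exp e he he1 a
    (PadicInertiaCharacter.exists_continuousMonoidHom_factor p a) hram i

/-- **S29 K4's hypothesis `hSen` (v3) — UNCONDITIONAL, every prime `p`** (x11b3-p7 instantiates
`p := 3` under `haveI := Padic.isNonarchimedeanLocalField_holds 3`): for any family of continuous
extensions `T τ` of the automorphisms of `ℚ̄_p` to `ℂ_[p]` and any additive continuous
`a : Aut(ℚ̄_p/ℚ_p) → ℤ_p`, if small `ℚ_p`-rational base points `w` with continuous `ψ : ℤ_p → ℂ_pˣ`,
`ψ(1) = w`, always admit a non-zero `q` with `T τ q = ψ(a τ) q` for all `τ`, then `a` vanishes on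
every `τ` fixing the roots of unity of order prime to `p`. Inputs, all tree theorems: local
Kronecker–Weber in inertia form for `ℚ_[p]` (`PadicInertiaCharacter.exists_continuousMonoidHom_factor`),
Lang's theorem (§1), Tate's theorem (§2), the transport `ℂ_{ℚ_p} ≅ ℂ_[p]`
(`X11b/PadicComplexTransport`). NO Sen theory.
[cite: Tate1967, §3.3 Theorem 2] [cite: SerreLocalFields1979, Ch. XIV §7 Thm. 2] -/
theorem apply_eq_zero_of_forall_exists_semiInvariant
    (T : (PadicAlgCl p ≃ₐ[ℚ_[p]] PadicAlgCl p) → ℂ_[p] →+* ℂ_[p]) (hT : ∀ τ, Continuous (T τ))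
    (hTτ : ∀ τ (x : PadicAlgCl p), T τ x = τ x)
    (a : (PadicAlgCl p ≃ₐ[ℚ_[p]] PadicAlgCl p) → ℤ_[p]) (hadd : ∀ τ₁ τ₂, a (τ₁ * τ₂) = a τ₁ + a τ₂)
    (hcont : Continuous a)
    (H : ∃ δ : ℝ, 0 < δ ∧ ∀ (w : ℚ_[p]) (ψ : Multiplicative ℤ_[p] →* ℂ_[p]ˣ), Continuous ψ →
      ((ψ (Multiplicative.ofAdd 1) : ℂ_[p]ˣ) : ℂ_[p]) = algebraMap ℚ_[p] ℂ_[p] w →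
      ‖algebraMap ℚ_[p] ℂ_[p] w - 1‖ < δ →
      ∃ q : ℂ_[p], q ≠ 0 ∧ ∀ τ, T τ q = ((ψ (Multiplicative.ofAdd (a τ)) : ℂ_[p]ˣ) : ℂ_[p]) * q)
    (τ : PadicAlgCl p ≃ₐ[ℚ_[p]] PadicAlgCl p)
    (hτ : ∀ ζ : PadicAlgCl p, (∃ m : ℕ, 0 < m ∧ ¬ p ∣ m ∧ ζ ^ m = 1) → τ ζ = ζ) :
    a τ = 0 :=
  apply_eq_zero_of_forall_exists_semiInvariant_of_factor
    (PadicInertiaCharacter.exists_continuousMonoidHom_factor p) T hT hTτ a hadd hcont H τ hτ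

end Padic

end Summit.BirchSwinnertonDyer.Rank1Residual.X11b.PadicSemiInvariant

end
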